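import Literature.Computability.Complexity.CodeFPListKit
import Literature.Computability.Complexity.CodeFPBudgets
import Summits.PneNP.PneNP.Theorems.LtfLocalAvoidFPMachine

/-!
# F-N2a FP wrapper for general LTF tables, part 2/2: `ltfStr` is polynomial time, and the packaged rung

Cell pnp-ideate, ROUND-17 rung F-N2a (`--supports stmt-PneNP-19007`).  Part 1 (`LtfLocalAvoidFPMachine`)
defined the machine `ltfStr k F0 F1` (decode the instance code, weight each output's positions by the
certificate row `(F0 P, F1 P ·)` of its table `P`, run the weighted greedy signing as a fold) and proved
`readOut m (ltfStr k F0 F1 (encode I)) = LtfGreedySigning.greedyBitsW I c` whenever the certificate `c`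
has the table-determined rows `c0 j = F0 (I.table j)`, `c1 j i = F1 (I.table j) i`.  This part:

* TYPING in the `CodeFP` algebra: the certificate row is a FINITE LOOKUP over the `2^(2ᵏ)` table blocks
  (`CodeFP.ofList` on `allBits (2ᵏ)`), the weighted rows by `map`/`rawZip`, the pass by `foldl₀` with the
  linear accumulator bound `length_stE_le`, bias/loads/correlations by `intSum`/`map`/`ite`; hence
  `isPolyTime_ltfStr`.
* THE PACKAGED RUNG `ltf_rungFP_of_certs`: if every instance of a class `Q` carries a degree-≤1 certificate
  with table-determined rows `(F0, F1)`, positive margin and ℓ₁ weight ≤ `W`, then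
  `LocalAvoidLinearFP k Q` with `C = 2W² + 1` (via `LtfGreedySigning.greedyBitsW_not_mem_range`).  The
  sign-degree-1 leaf follows by instantiating `(F0, F1, W)` from a uniform integer certificate table
  (`SignDegIntCert.exists_uniform_intCert` + a bridge to `SignRepCertificate.Cert`), not done here.

Restricted-model algorithmic rung of the range-avoidance ladder; no bearing on `P` versus `NP`.
-/

set_option linter.dupNamespace false -- `Summit.PneNP.PneNP.…`: summit = sub-problem name (D-0017 single-conjunct layout)

namespace Summit.PneNP.PneNP.Theorems.LtfLocalAvoidFP

open Literature.Computability.Complexity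
open Summit.PneNP.PneNP.Theorems.LtfLocalAvoidCore (sgnZ)
open Summit.PneNP.PneNP.Theorems.SignRepCertificate (Cert)
open Summit.PneNP.PneNP.Theorems.LtfGreedySigning
open Summit.PneNP.PneNP.Theorems.LocalMapDecodeFP

variable {k n m : ℕ}

section PolyTime

open CodeFP Polynomial

/-- Code of a certificate row `(c0, [c1 i]_i)`. -/
abbrev cE : ℤ × List ℤ → List Bool := pairE intE (rawE intE)

/-- Code of a weighted row `(c0, [(position, c1)]_i)`. -/
abbrev wrE : ℤ × List (ℕ × ℤ) → List Bool := pairE intE (rawE (pairE natE intE))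

/-- Code of a signed weighted row. -/
abbrev sE : Bool × (ℤ × List (ℕ × ℤ)) → List Bool := pairE bitE wrE

/-- Code of the state of the pass. -/
abbrev stE : List (Bool × (ℤ × List (ℕ × ℤ))) → List Bool := rawE sE

variable (k : ℕ) (F0 : ((Fin k → Bool) → Bool) → ℤ) (F1 : ((Fin k → Bool) → Bool) → Fin k → ℤ)

/-- The certificate row is a finite lookup, hence polynomial time. -/
theorem codeFP_certRow : CodeFP strE cE (certRow k F0 F1) := by
  have he : Function.Injective strE := fun _ _ h => h
  have h := ofList (eα := strE) he cE
    (fun tab => (F0 (tableOfBits k tab), List.ofFn fun i : Fin k => F1 (tableOfBits k tab) i))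
    ((0 : ℤ), ([] : List ℤ)) (allBits (2 ^ k))
  exact h.congr fun tab => by
    unfold certRow
    split_ifs <;> rfl

/-- Weighting a decoded output is polynomial time. -/
theorem codeFP_wrowOf : CodeFP outE wrE (wrowOf k F0 F1) := by
  have hc : CodeFP outE cE (fun o => certRow k F0 F1 o.1) := (codeFP_certRow k F0 F1).comp (fst strE (rawE natE))
  exact (hc.fst'.pair ((rawZip natE intE).comp ((snd strE (rawE natE)).pair hc.snd'))).congr fun _ => rfl

/-- The bias slot is polynomial time. -/
theorem codeFP_biasOf : CodeFP stE intE biasOf := by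
  have hg : CodeFP sE intE (fun p => sgnZ p.1 * p.2.1) :=
    ((fst bitE wrE).ite (intNeg.comp (snd bitE wrE).fst') (snd bitE wrE).fst').congr fun p => by
      obtain ⟨b, wr⟩ := p
      cases b <;> simp [sgnZ]
  exact (intSum.comp (map₀ hg)).congr fun _ => rfl

/-- The weight of one weighted row on a position is polynomial time. -/
theorem codeFP_pload : CodeFP (pairE natE (rawE (pairE natE intE))) intE (fun p => pload p.2 p.1) := by
  have hg : CodeFP (pairE natE (pairE natE intE)) intE (fun t => if t.2.1 = t.1 then t.2.2 else 0) :=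
    ((natEq.comp ((snd natE (pairE natE intE)).fst'.pair (fst natE (pairE natE intE)))).ite
      (snd natE (pairE natE intE)).snd' (const _ (0 : ℤ))).congr fun t => by
        by_cases h : t.2.1 = t.1 <;> simp [h]
  exact (intSum.comp (map hg)).congr fun _ => rfl

/-- The load of a position is polynomial time. -/
theorem codeFP_loadOf : CodeFP (pairE natE stE) intE (fun p => loadOf p.2 p.1) := by
  have hpl : CodeFP (pairE natE sE) intE (fun t => pload t.2.2.2 t.1) :=
    (codeFP_pload.comp ((fst natE sE).pair (snd natE sE).snd'.snd')).congr fun _ => rfl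
  have hg : CodeFP (pairE natE sE) intE (fun t => sgnZ t.2.1 * pload t.2.2.2 t.1) :=
    ((snd natE sE).fst'.ite (intNeg.comp hpl) hpl).congr fun t => by
      obtain ⟨v, b, wr⟩ := t
      cases b <;> simp [sgnZ]
  exact (intSum.comp (map hg)).congr fun _ => rfl

/-- The correlation of a weighted row is polynomial time. -/
theorem codeFP_corrOf : CodeFP (pairE stE wrE) intE (fun p => corrOf p.1 p.2) := by
  have h1 : CodeFP (pairE stE wrE) intE (fun p => p.2.1 * biasOf p.1) :=
    (intMul.comp ((snd stE wrE).fst'.pair (codeFP_biasOf.comp (fst stE wrE)))).congr fun _ => rfl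
  have hg : CodeFP (pairE (pairE stE wrE) (pairE natE intE)) intE (fun t => t.2.2 * loadOf t.1.1 t.2.1) :=
    (intMul.comp ((snd (pairE stE wrE) (pairE natE intE)).snd'.pair
      (codeFP_loadOf.comp ((snd (pairE stE wrE) (pairE natE intE)).fst'.pair
        (fst (pairE stE wrE) (pairE natE intE)).fst')))).congr fun _ => rfl
  have h2 : CodeFP (pairE stE wrE) intE (fun p => (p.2.2.map fun q => q.2 * loadOf p.1 q.1).sum) :=
    (intSum.comp ((map hg).comp ((CodeFP.id (pairE stE wrE)).pair (snd stE wrE).snd'))).congr fun _ => rfl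
  exact (intAdd.comp (h1.pair h2)).congr fun _ => rfl

/-- One step of the pass is polynomial time. -/
theorem codeFP_sigStep : CodeFP (pairE wrE stE) stE (fun t => sigStep t.1 t.2) := by
  have hcorr : CodeFP (pairE wrE stE) intE (fun t => corrOf t.2 t.1) :=
    (codeFP_corrOf.comp ((snd wrE stE).pair (fst wrE stE))).congr fun _ => rfl
  have hbit : CodeFP (pairE wrE stE) bitE (fun t => decide (0 < corrOf t.2 t.1)) :=
    (intLt.comp ((const (pairE wrE stE) (0 : ℤ)).pair hcorr)).congr fun _ => rfl
  have hitem : CodeFP (pairE wrE stE) sE (fun t => (decide (0 < corrOf t.2 t.1), t.1)) := hbit.pair (fst wrE stE)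
  exact ((rawAppend sE).comp ((snd wrE stE).pair ((rawSingleton sE).comp hitem))).congr fun _ => rfl

/-- The code of a state is linear in the code of its weighted rows. -/
theorem length_stE_le : ∀ st : List (Bool × (ℤ × List (ℕ × ℤ))), (stE st).length ≤ 5 * (rawE wrE (st.map Prod.snd)).length
  | [] => by simp
  | (b, wr) :: st => by
    have ih := length_stE_le st
    show (rawE sE ((b, wr) :: st)).length ≤ 5 * (rawE wrE (((b, wr) :: st).map Prod.snd)).length
    rw [List.map_cons, rawE_cons, rawE_cons, length_boolPair, length_boolPair]
    show 2 * (pairE bitE wrE (b, wr)).length + 2 + (stE st).length ≤ _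
    rw [pairE_apply, length_boolPair]
    simp only [bitE, List.length_singleton]
    omega

/-- The pass keeps the weighted rows (length bookkeeping form). -/
theorem map_snd_sigRun (l : List (ℤ × List (ℕ × ℤ))) :
    (l.foldl (fun st wr => sigStep wr st) []).map Prod.snd = l := by
  rw [map_snd_foldl_sigStep, List.map_nil, List.nil_append]

/-- The pass is polynomial time (the state stays linear in the input). -/
theorem codeFP_sigRun : CodeFP (rawE wrE) stE sigRun := by
  have h := foldl₀ (eα := wrE) (eβ := stE) (step := sigStep) (b₀ := ([] : List (Bool × (ℤ × List (ℕ × ℤ)))))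
    codeFP_sigStep (5 * X) (fun l₁ l₂ => by
      have h1 := length_stE_le (l₁.foldl (fun st wr => sigStep wr st) [])
      rw [map_snd_sigRun] at h1
      have h2 : (rawE wrE l₁).length ≤ (rawE wrE (l₁ ++ l₂)).length :=
        length_rawE_le_of_sublist wrE (List.sublist_append_left l₁ l₂)
      simp only [eval_mul, eval_ofNat, eval_X]
      omega)
  exact h.congr fun _ => rfl

/-- **The machine is computed on codes by an `FP` string function** (plain strings in and out). -/
theorem codeFP_ltfStr : CodeFP strE strE (ltfStr k F0 F1) :=
  (bitsToStr.comp ((map₀ (fst bitE wrE)).comp (codeFP_sigRun.comp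
    ((map₀ (codeFP_wrowOf k F0 F1)).comp (codeFP_decode k))))).congr fun _ => rfl

/-- **`ltfStr k F0 F1 ∈ FP`.** -/
theorem ltfStr_mem_FP : ltfStr k F0 F1 ∈ FP := by
  obtain ⟨f, hf, hfw⟩ := codeFP_ltfStr k F0 F1
  have h : f = ltfStr k F0 F1 := funext fun w => hfw w
  rw [← h]
  exact hf

/-- **`ltfStr k F0 F1` is polynomial-time computable** in the sense of `LocalAvoidLinearFP` (`IsPolyTime`). -/
theorem isPolyTime_ltfStr : IsPolyTime (ltfStr k F0 F1) := (isPolyTime_iff _).mpr (ltfStr_mem_FP k F0 F1)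

end PolyTime

/-! ## The packaged rung -/

/-- **F-N2a for table-certified classes, literally typed.**  Let `Q` be a class of `k`-local maps such that
every `I ∈ Q` carries a degree-≤1 sign-representation certificate (`SignRepCertificate.Cert I`, no quadratic
part) whose rows are the FIXED functions `(F0, F1)` of the output's table, with positive margin and ℓ₁
weight at most `W`.  Then `NC⁰ₖ` range avoidance restricted to `Q` is solved at linear stretch
`m ≥ (2W² + 1)·n` by ONE polynomial-time string function — the weighted one-pass greedy signing
`ltfStr k F0 F1`.  (Restricted-model algorithmic rung; no bearing on `P ≠ NP`.) -/
theorem ltf_rungFP_of_certs (k : ℕ) (Q : ∀ ⦃n m : ℕ⦄, LocalMap k n m → Prop)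
    (F0 : ((Fin k → Bool) → Bool) → ℤ) (F1 : ((Fin k → Bool) → Bool) → Fin k → ℤ) (W : ℕ)
    (hcert : ∀ ⦃n m : ℕ⦄ (I : LocalMap k n m), Q I → ∃ c : Cert I,
      (∀ j i i', c.c2 j i i' = 0) ∧ (∀ j, c.c0 j = F0 (I.table j)) ∧ (∀ j i, c.c1 j i = F1 (I.table j) i) ∧
        0 < c.τ ∧ ∀ j, |c.c0 j| + ∑ i : Fin k, |c.c1 j i| ≤ (W : ℤ)) :
    LocalAvoidLinearFP k Q := by
  refine ⟨2 * W ^ 2 + 1, ltfStr k F0 F1, isPolyTime_ltfStr k F0 F1, fun n m I hQ hn hm => ?_⟩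
  obtain ⟨c, hc2, hc0, hc1, hτ, hW⟩ := hcert I hQ
  rw [readOut_ltfStr I c hc0 hc1]
  refine greedyBitsW_not_mem_range I c hc2 W hW hτ ?_
  have hn' : (1 : ℤ) ≤ n := by exact_mod_cast hn
  have hm' : ((2 * (W : ℤ) ^ 2 + 1) * n) ≤ (m : ℤ) := by exact_mod_cast hm
  have hτ2 : (1 : ℤ) ≤ c.τ ^ 2 := by nlinarith
  have hm0 : (0 : ℤ) ≤ m := by exact_mod_cast Nat.zero_le m
  calc ((n : ℤ) + 1) * (W : ℤ) ^ 2 ≤ 2 * n * (W : ℤ) ^ 2 := mul_le_mul_of_nonneg_right (by linarith) (sq_nonneg _)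
    _ < (2 * (W : ℤ) ^ 2 + 1) * n := by nlinarith
    _ ≤ m := hm'
    _ ≤ c.τ ^ 2 * m := le_mul_of_one_le_left hm0 hτ2

end Summit.PneNP.PneNP.Theorems.LtfLocalAvoidFP
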